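import Summits.QuantumFields.YangMills.Theorems.LangevinControlUVOSLegsFromFemtoAndGapStubLowerThreePoint

/-!
# Stub `stub_lower` of line `dlr-collar-transfer` (crux `OSLegsFromFemtoAndGap`, stmt-QuantumFields-9367):
# the three-point half of `LowerBounds`

`lowerBounds_threePoint`: `(∀ β, 0 < a β) → a → 0 → FBL → FC2 → FC3 → (LowerBounds G r a).2`, i.e. three
real bumps `f, g, h` with pairwise disjoint supports (at `0`, `s v⃗`, `s w⃗`, radius `δ s/4`) and `ε > 0`
with `|Q3(f, g, h)| ≥ ε` on every large torus at every large coupling: scale selection inside the growth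
clauses of FC2 and FC3, the per-triple signed floor `triple_floor`, positivity of the bump weights and the
Riemann mass of the three plateaux.
-/

set_option autoImplicit false

noncomputable section

open scoped SchwartzMap
open MeasureTheory Filter Topology Metric
open Literature.MathematicalPhysics.QuantumFieldTheory Literature.MathematicalPhysics.QuantumLattice
open Literature.MathematicalPhysics.AQFT Literature.Probability.LatticeModels
open Summit.QuantumFields.YangMills.Theorems.OSLegsFromFemtoAndGap.StubLower

namespace Summit.QuantumFields.YangMills.Cruxes.OSLegsFromFemtoAndGap.DlrCollarTransfer.StubLower

/-- A weighted triple sum with non-negative weights dominates `κ · (Σf)(Σg)(Σh)` as soon as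
`κ ≤ C x y z` on the triples that are actually weighted. [folklore] -/
theorem mul_sum_mul_sum_mul_sum_le {B : Finset (Fin 4 → ℤ)} {f g h : (Fin 4 → ℤ) → ℝ}
    {C : (Fin 4 → ℤ) → (Fin 4 → ℤ) → (Fin 4 → ℤ) → ℝ} {κ : ℝ} (hf : ∀ x, 0 ≤ f x)
    (hg : ∀ y, 0 ≤ g y) (hh : ∀ z, 0 ≤ h z)
    (hC : ∀ x y z, f x ≠ 0 → g y ≠ 0 → h z ≠ 0 → κ ≤ C x y z) :
    κ * ((∑ x ∈ B, f x) * (∑ y ∈ B, g y) * (∑ z ∈ B, h z)) ≤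
      ∑ x ∈ B, ∑ y ∈ B, ∑ z ∈ B, f x * g y * h z * C x y z := by
  rw [Finset.sum_mul_sum, Finset.sum_mul, Finset.mul_sum]
  refine Finset.sum_le_sum fun x _ => ?_
  rw [Finset.sum_mul, Finset.mul_sum]
  refine Finset.sum_le_sum fun y _ => ?_
  rw [Finset.mul_sum, Finset.mul_sum]
  refine Finset.sum_le_sum fun z _ => ?_
  by_cases hx : f x = 0
  · simp [hx]
  by_cases hy : g y = 0
  · simp [hy]
  by_cases hz : h z = 0
  · simp [hz]
  have := hC x y z hx hy hz
  have hfgh : 0 ≤ f x * g y * h z := mul_nonneg (mul_nonneg (hf x) (hg y)) (hh z)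
  nlinarith

/-- The constant `M₃ = 12C₁C₂⁺/(c₃D⁴Vmin⁸) + 16C₁³smax⁸/(c₃D¹²) + 1` beats the mixed and triple boundary
terms at every scale `s ≤ smax`. [folklore] -/
theorem M3_bound {C₁ C₂p c₃ D Vmin smax s : ℝ} (hC₁ : 0 ≤ C₁) (hc₃ : 0 < c₃) (hD : 0 < D)
    (hVmin : 0 < Vmin) (hs : 0 < s) (hsmax : s ≤ smax) :
    6 * C₁ * C₂p / (D ^ 4 * (s * Vmin) ^ 8) + 8 * C₁ ^ 3 / D ^ 12 ≤
      c₃ * (12 * C₁ * C₂p / (c₃ * D ^ 4 * Vmin ^ 8) + 16 * C₁ ^ 3 * smax ^ 8 / (c₃ * D ^ 12) + 1) /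
        (2 * s ^ 8) := by
  have hc0 : c₃ ≠ 0 := hc₃.ne'
  have hD0 : D ≠ 0 := hD.ne'
  have hV0 : Vmin ≠ 0 := hVmin.ne'
  have hs0 : s ≠ 0 := hs.ne'
  have e : c₃ * (12 * C₁ * C₂p / (c₃ * D ^ 4 * Vmin ^ 8) + 16 * C₁ ^ 3 * smax ^ 8 / (c₃ * D ^ 12) + 1) /
      (2 * s ^ 8) = 6 * C₁ * C₂p / (D ^ 4 * (s * Vmin) ^ 8) +
        8 * C₁ ^ 3 / D ^ 12 * (smax ^ 8 / s ^ 8) + c₃ / (2 * s ^ 8) := by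
    field_simp
    ring
  rw [e]
  have h1 : 1 ≤ smax ^ 8 / s ^ 8 := by
    rw [one_le_div (by positivity)]; exact pow_le_pow_left₀ hs.le hsmax 8
  have h2 : 8 * C₁ ^ 3 / D ^ 12 ≤ 8 * C₁ ^ 3 / D ^ 12 * (smax ^ 8 / s ^ 8) :=
    le_mul_of_one_le_right (by positivity) h1
  have h3 : 0 ≤ c₃ / (2 * s ^ 8) := by positivity
  linarith

/-- Constants bookkeeping for the three-point scale (`ℓ = min ℓ₁ ℓ₂ ℓ₃`): the cube is femto, fits in
every torus with `ℓ ≤ α L`, and the pair separations stay in `(0, ℓ₂]`. [folklore] -/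
theorem femto_budget3 {ℓ ℓ₁ ℓ₂ ℓ₃ s k k₃ V α : ℝ} {L : ℕ} (hℓ : 0 ≤ ℓ) (hℓ₁ : ℓ ≤ ℓ₁)
    (hℓ₂ : ℓ ≤ ℓ₂) (hℓ₃ : ℓ ≤ ℓ₃) (hk : s * V * k < ℓ / 10) (hk₃ : s * k₃ < ℓ / 10)
    (hsV : s * V ≤ ℓ / 100) (hα : α ≤ ℓ / 100) (hL : ℓ ≤ α * L) :
    2 * (k * (s * V) + k₃ * s + ℓ / 100 + s * V) + 7 * α ≤ ℓ₁ ∧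
      2 * (k * (s * V) + k₃ * s + ℓ / 100 + s * V) + 7 * α ≤ ℓ₂ ∧
      2 * (k * (s * V) + k₃ * s + ℓ / 100 + s * V) + 7 * α ≤ ℓ₃ ∧
      k * (s * V) + k₃ * s + ℓ / 100 + s * V + 4 * α ≤ α * L ∧ s * V ≤ ℓ₂ := by
  have e1 : k * (s * V) = s * V * k := by ring
  have e2 : k₃ * s = s * k₃ := by ring
  rw [e1, e2]
  refine ⟨by linarith, by linarith, by linarith, by linarith, by linarith⟩

/-- Geometry of the shape: `Vmin = min(‖v‖, ‖w‖, ‖w - v‖) - δ/2 > 0`, `Vmax = max(…) + δ/2`. [folklore] -/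
theorem shape_constants {v w : EuclideanSpace ℝ (Fin 4)} {δ : ℝ} (hδ : 0 < δ) (hv : 2 * δ < ‖v‖)
    (hw : 2 * δ < ‖w‖) (hvw : 2 * δ < ‖v - w‖) :
    ∃ Vmin Vmax : ℝ, 0 < Vmin ∧ 0 < Vmax ∧ Vmin ≤ Vmax ∧
      Vmin ≤ ‖v‖ - δ / 2 ∧ Vmin ≤ ‖w‖ - δ / 2 ∧ Vmin ≤ ‖w - v‖ - δ / 2 ∧
      ‖v‖ + δ / 2 ≤ Vmax ∧ ‖w‖ + δ / 2 ≤ Vmax ∧ ‖w - v‖ + δ / 2 ≤ Vmax ∧ δ ≤ Vmax := by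
  rw [norm_sub_rev] at hvw
  refine ⟨min (min ‖v‖ ‖w‖) ‖w - v‖ - δ / 2, max (max ‖v‖ ‖w‖) ‖w - v‖ + δ / 2, ?_, ?_, ?_, ?_, ?_,
    ?_, ?_, ?_, ?_, ?_⟩
  · have : 2 * δ < min (min ‖v‖ ‖w‖) ‖w - v‖ := lt_min (lt_min hv hw) hvw
    linarith
  · have : 2 * δ < max (max ‖v‖ ‖w‖) ‖w - v‖ := hv.trans_le ((le_max_left _ _).trans (le_max_left _ _))
    linarith
  · have : min (min ‖v‖ ‖w‖) ‖w - v‖ ≤ max (max ‖v‖ ‖w‖) ‖w - v‖ :=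
      (min_le_right _ _).trans (le_max_right _ _)
    linarith
  · linarith [((min_le_left _ _).trans (min_le_left _ _) : min (min ‖v‖ ‖w‖) ‖w - v‖ ≤ ‖v‖)]
  · linarith [((min_le_left _ _).trans (min_le_right _ _) : min (min ‖v‖ ‖w‖) ‖w - v‖ ≤ ‖w‖)]
  · linarith [(min_le_right _ _ : min (min ‖v‖ ‖w‖) ‖w - v‖ ≤ ‖w - v‖)]
  · linarith [((le_max_left _ _).trans (le_max_left _ _) : ‖v‖ ≤ max (max ‖v‖ ‖w‖) ‖w - v‖)]
  · linarith [((le_max_right _ _).trans (le_max_left _ _) : ‖w‖ ≤ max (max ‖v‖ ‖w‖) ‖w - v‖)]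
  · linarith [(le_max_right _ _ : ‖w - v‖ ≤ max (max ‖v‖ ‖w‖) ‖w - v‖)]
  · have : 2 * δ < max (max ‖v‖ ‖w‖) ‖w - v‖ := hv.trans_le ((le_max_left _ _).trans (le_max_left _ _))
    linarith

/-- The three plateaux are covered by the box: `|c j| + δ s / 8 ≤ α L` for centres `c` of norm
`≤ s Vmax` once `2 s Vmax ≤ α L` and `δ ≤ Vmax`. [folklore] -/
theorem centre_cover {c : EuclideanSpace ℝ (Fin 4)} {s δ Vmax α : ℝ} {L : ℕ} (hs : 0 ≤ s)
    (hc : ‖c‖ ≤ s * Vmax) (hδV : δ ≤ Vmax) (hL : 2 * (s * Vmax) ≤ α * L) (j : Fin 4) :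
    |c j| + δ * s / 8 ≤ α * L := by
  have h1 := (abs_apply_le_norm c j).trans hc
  have h2 : δ * s ≤ s * Vmax := by nlinarith
  linarith [abs_nonneg (c j)]

section ThreePoint

variable (G : Type) [Group G] [TopologicalSpace G] [IsTopologicalGroup G] [CompactSpace G]
  [MeasurableSpace G] [BorelSpace G] (r : LatticeRep G) (a : ℝ → ℝ)

/-- **The three-point half of `LowerBounds`.** [folklore] -/
theorem lowerBounds_threePoint (hapos : ∀ β, 0 < a β) (hlim : Tendsto a atTop (𝓝 0))
    (hFBL : FBL G r a) (hFC2 : FC2 G r a) (hFC3 : FC3 G r a) :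
    ∃ (f g h : 𝓢(EuclideanSpace ℝ (Fin 4), ℝ)) (ε β₅ Λ₅ : ℝ),
      Disjoint (tsupport f) (tsupport g) ∧ Disjoint (tsupport g) (tsupport h) ∧
      Disjoint (tsupport f) (tsupport h) ∧ 0 < ε ∧
      ∀ β : ℝ, β₅ ≤ β → ∀ L : ℕ, Λ₅ ≤ a β * L → ε ≤ |Q3 G r β L (a β) f g h| := by
  obtain ⟨C₁, β₁, ℓ₁, p, hℓ₁, hC₁, hFBLc⟩ := hFBL
  obtain ⟨Γ, β₂, ℓ₂, c₂, C₂, K, n₀, hℓ₂, hc₂, hK1, hKlim, hn₀, -, hΓ1, -, hFC2c⟩ := hFC2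
  obtain ⟨v, w, σ, δ, Γ₃, β₃, ℓ₃, c₃, K₃, n₃, hσ, hδ, h2v, h2w, h2vw, hℓ₃, hc₃, hK₃1, hK₃lim, -, -,
    -, hΓ₃lim, hFC3c⟩ := hFC3
  -- the constants
  obtain ⟨ℓ, hℓ⟩ : ∃ ℓ : ℝ, ℓ = min (min ℓ₁ ℓ₂) ℓ₃ := ⟨_, rfl⟩
  have hℓ0 : 0 < ℓ := by rw [hℓ]; exact lt_min (lt_min hℓ₁ hℓ₂) hℓ₃
  have hℓℓ₁ : ℓ ≤ ℓ₁ := hℓ ▸ (min_le_left _ _).trans (min_le_left _ _)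
  have hℓℓ₂ : ℓ ≤ ℓ₂ := hℓ ▸ (min_le_left _ _).trans (min_le_right _ _)
  have hℓℓ₃ : ℓ ≤ ℓ₃ := hℓ ▸ min_le_right _ _
  obtain ⟨Vmin, Vmax, hVmin, hVmax, hVV, hVv, hVw, hVvw, hVv', hVw', hVvw', hδV⟩ :=
    shape_constants hδ h2v h2w h2vw
  obtain ⟨D, hD⟩ : ∃ D : ℝ, D = ℓ / 100 := ⟨_, rfl⟩
  have hD0 : 0 < D := by rw [hD]; positivity
  obtain ⟨smax, hsmax⟩ : ∃ smax : ℝ, smax = ℓ / (100 * (Vmax + 1)) := ⟨_, rfl⟩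
  have hsmax0 : 0 < smax := by rw [hsmax]; positivity
  have hC₂p : 0 ≤ max C₂ 0 := le_max_right _ _
  obtain ⟨M₃, hM₃⟩ : ∃ M₃ : ℝ, M₃ = 12 * C₁ * max C₂ 0 / (c₃ * D ^ 4 * Vmin ^ 8)
    + 16 * C₁ ^ 3 * smax ^ 8 / (c₃ * D ^ 12) + 1 := ⟨_, rfl⟩
  have hM₃0 : 0 < M₃ := by rw [hM₃]; positivity
  obtain ⟨δ₁, hδ₁, hKδ⟩ := exists_delta_of_tendsto_mul hKlim (ε := ℓ * Vmin / (10 * Vmax)) (by positivity)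
  obtain ⟨δ₂, hδ₂, hK₃δ⟩ := exists_delta_of_tendsto_mul hK₃lim (ε := ℓ / 20) (by positivity)
  obtain ⟨δ₃, hδ₃, hΓ₃δ⟩ := exists_delta_of_tendsto_div_atTop hΓ₃lim M₃
  obtain ⟨s, hs⟩ : ∃ s : ℝ, s = min (min (δ₁ / (2 * (Vmin + 1))) δ₂) (min (δ₃ / 2) smax) := ⟨_, rfl⟩
  have hs0 : 0 < s := by rw [hs]; positivity
  have hs₁ : s ≤ δ₁ / (2 * (Vmin + 1)) := hs ▸ (min_le_left _ _).trans (min_le_left _ _)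
  have hs₂ : s ≤ δ₂ := hs ▸ (min_le_left _ _).trans (min_le_right _ _)
  have hs₃ : s ≤ δ₃ / 2 := hs ▸ (min_le_right _ _).trans (min_le_left _ _)
  have hs₄ : s ≤ smax := hs ▸ (min_le_right _ _).trans (min_le_right _ _)
  have hsδ₃ : s < δ₃ := by linarith only [hs₃, hδ₃]
  have hsV : s * Vmax ≤ ℓ / 100 := by
    have h1 : s * Vmax ≤ smax * Vmax := mul_le_mul_of_nonneg_right hs₄ hVmax.le
    have h2 : smax * Vmax ≤ ℓ / 100 := by
      rw [hsmax, div_mul_eq_mul_div, div_le_div_iff₀ (by positivity) (by positivity)]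
      have : 0 ≤ ℓ * 100 := by positivity
      linarith only [this]
    linarith only [h1, h2]
  have hsℓ : s ≤ ℓ / 100 := by
    have : smax ≤ ℓ / 100 :=
      hsmax ▸ div_le_div_of_nonneg_left hℓ0.le (by positivity) (by linarith only [hVmax])
    linarith only [this, hs₄]
  -- growth clauses at the scale `s`
  have hsVmin : s * Vmin < δ₁ := by
    have h1 : s * Vmin ≤ δ₁ / (2 * (Vmin + 1)) * Vmin := mul_le_mul_of_nonneg_right hs₁ hVmin.le
    have h2 : δ₁ / (2 * (Vmin + 1)) * Vmin < δ₁ := by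
      rw [div_mul_eq_mul_div, div_lt_iff₀ (by positivity)]
      exact mul_lt_mul_of_pos_left (by linarith only [hVmin]) hδ₁
    linarith only [h1, h2]
  have hs0' : s ≠ 0 := hs0.ne'
  have hVmin0 : Vmin ≠ 0 := hVmin.ne'
  have hVmax0 : Vmax ≠ 0 := hVmax.ne'
  have hKt : s * Vmax * K (s * Vmin) < ℓ / 10 := by
    have h1 := hKδ (s * Vmin) (by positivity) hsVmin
    have e : s * Vmax * K (s * Vmin) = s * Vmin * K (s * Vmin) * (Vmax / Vmin) := by
      field_simp
    rw [e]
    calc s * Vmin * K (s * Vmin) * (Vmax / Vmin) < ℓ * Vmin / (10 * Vmax) * (Vmax / Vmin) :=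
          mul_lt_mul_of_pos_right h1 (by positivity)
      _ = ℓ / 10 := by field_simp
  have hK₃t : s * K₃ (s / 2) < ℓ / 10 := by
    have := hK₃δ (s / 2) (by positivity) (by linarith only [hs₂, hs0])
    linarith only [this]
  have hM₃C := M3_bound (C₂p := max C₂ 0) hC₁ hc₃ hD0 hVmin hs0 hs₄
  rw [← hM₃] at hM₃C
  -- the three bumps: plateau radius `δ s / 8`, support radius `δ s / 4`
  have hρ : 0 < δ * s / 8 := by positivity
  obtain ⟨f, hf0, -, hfone, hfsupp, hfts⟩ :=
    exists_bump_schwartz (0 : EuclideanSpace ℝ (Fin 4)) (ρ := δ * s / 8) hρ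
  obtain ⟨g, hg0, -, hgone, hgsupp, hgts⟩ := exists_bump_schwartz (s • v) (ρ := δ * s / 8) hρ
  obtain ⟨h, hh0, -, hhone, hhsupp, hhts⟩ := exists_bump_schwartz (s • w) (ρ := δ * s / 8) hρ
  -- small spacings
  have hn₀0 : (0 : ℝ) < n₀ := by exact_mod_cast hn₀
  obtain ⟨β₀, hβ₀⟩ := exists_of_tendsto_atTop_nhds_zero hlim
    (a₀ := min (min (min (ℓ / 100) (δ * s / 16)) (min (s / 2) (s / ((n₃ : ℝ) + 1))))
      (min (min (δ * s / (2 * (‖v‖ + δ))) (δ * s / (2 * (‖w‖ + δ)))) (s * Vmin / n₀)))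
    (by positivity)
  refine ⟨f, g, h, c₃ * M₃ / (2 * s ^ 8) * (δ * s / 16) ^ 12, max (max β₀ β₁) (max β₂ β₃), ℓ,
    ?_, ?_, ?_, by positivity, ?_⟩
  · rw [hfts, hgts]
    refine closedBall_disjoint_closedBall ?_
    rw [dist_eq_norm, zero_sub, norm_neg, norm_smul, Real.norm_eq_abs, abs_of_pos hs0]
    have := mul_lt_mul_of_pos_left (show δ / 2 < ‖v‖ by linarith only [h2v, hδ]) hs0
    linarith only [this]
  · rw [hgts, hhts]
    refine closedBall_disjoint_closedBall ?_
    rw [dist_eq_norm, ← smul_sub, norm_smul, Real.norm_eq_abs, abs_of_pos hs0]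
    have := mul_lt_mul_of_pos_left (show δ / 2 < ‖v - w‖ by linarith only [h2vw, hδ]) hs0
    linarith only [this]
  · rw [hfts, hhts]
    refine closedBall_disjoint_closedBall ?_
    rw [dist_eq_norm, zero_sub, norm_neg, norm_smul, Real.norm_eq_abs, abs_of_pos hs0]
    have := mul_lt_mul_of_pos_left (show δ / 2 < ‖w‖ by linarith only [h2w, hδ]) hs0
    linarith only [this]
  intro β hβ L hL
  have hββ₀ : β₀ ≤ β := le_of_max_le_left (le_of_max_le_left hβ)
  have hββ₁ : β₁ ≤ β := le_of_max_le_right (le_of_max_le_left hβ)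
  have hββ₂ : β₂ ≤ β := le_of_max_le_left (le_of_max_le_right hβ)
  have hββ₃ : β₃ ≤ β := le_of_max_le_right (le_of_max_le_right hβ)
  have hα := hapos β
  have hαa₀ := (hβ₀ β hββ₀).le
  have hαℓ : a β ≤ ℓ / 100 :=
    hαa₀.trans ((min_le_left _ _).trans ((min_le_left _ _).trans (min_le_left _ _)))
  have hα16 : a β ≤ δ * s / 16 :=
    hαa₀.trans ((min_le_left _ _).trans ((min_le_left _ _).trans (min_le_right _ _)))
  have hα2 : a β ≤ s / 2 :=
    hαa₀.trans ((min_le_left _ _).trans ((min_le_right _ _).trans (min_le_left _ _)))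
  have hαn₃' : a β ≤ s / ((n₃ : ℝ) + 1) :=
    hαa₀.trans ((min_le_left _ _).trans ((min_le_right _ _).trans (min_le_right _ _)))
  have hαv' : a β ≤ δ * s / (2 * (‖v‖ + δ)) :=
    hαa₀.trans ((min_le_right _ _).trans ((min_le_left _ _).trans (min_le_left _ _)))
  have hαw' : a β ≤ δ * s / (2 * (‖w‖ + δ)) :=
    hαa₀.trans ((min_le_right _ _).trans ((min_le_left _ _).trans (min_le_right _ _)))
  have hαn₀' : a β ≤ s * Vmin / n₀ := hαa₀.trans ((min_le_right _ _).trans (min_le_right _ _))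
  have hαn₃ : ((n₃ : ℝ) + 1) * a β ≤ s := by
    rw [le_div_iff₀ (by positivity)] at hαn₃'; linarith only [hαn₃']
  have hαv : a β * (‖v‖ + δ) ≤ δ * s / 2 := by
    rw [le_div_iff₀ (by positivity)] at hαv'; linarith only [hαv']
  have hαw : a β * (‖w‖ + δ) ≤ δ * s / 2 := by
    rw [le_div_iff₀ (by positivity)] at hαw'; linarith only [hαw']
  have hαn₀ : (n₀ : ℝ) * a β ≤ s * Vmin := by
    rw [le_div_iff₀ hn₀0] at hαn₀'; linarith only [hαn₀']
  obtain ⟨hfem₁, hfem₂, hfem₃, hL', hsℓ₂⟩ := femto_budget3 (k := K (s * Vmin)) (k₃ := K₃ (s / 2))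
    (L := L) hℓ0.le hℓℓ₁ hℓℓ₂ hℓℓ₃ hKt hK₃t hsV hαℓ hL
  rw [← hD] at hfem₁ hfem₂ hfem₃ hL'
  -- the per-triple floor
  have key : ∀ x y z : Fin 4 → ℤ, f (a β • siteToE x) ≠ 0 → g (a β • siteToE y) ≠ 0 →
      h (a β • siteToE z) ≠ 0 → c₃ * M₃ / (2 * s ^ 8) * a β ^ 12 ≤ σ * torusK3 G r β L x y z := by
    intro x y z hx hy hz
    refine triple_floor G r a hC₁ hFBLc hc₂ hK1 hΓ1 hFC2c hσ hδ hc₃ hK₃1 hFC3c hs0 hD0 hM₃0.le hVmin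
      hVv hVw hVvw hVv' hVw' hVvw' hΓ₃δ hsδ₃ hsℓ₂ hM₃C hββ₁ hββ₂ hββ₃ hα hαn₀ hαn₃ hα2 hαv hαw
      hfem₁ hfem₂ hfem₃ hL' x y z ?_ ?_ ?_
    · have := hfsupp _ hx
      rw [dist_eq_norm, sub_zero] at this
      linarith only [this]
    · have := hgsupp _ hy
      rw [dist_eq_norm] at this
      linarith only [this]
    · have := hhsupp _ hz
      rw [dist_eq_norm] at this
      linarith only [this]
  -- Riemann mass of the three plateaux
  have hcov2 : 2 * (s * Vmax) ≤ a β * L := by linarith only [hsV, hL, hℓ0]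
  have hnv : ‖s • v‖ ≤ s * Vmax := by
    rw [norm_smul, Real.norm_eq_abs, abs_of_pos hs0]
    exact mul_le_mul_of_nonneg_left (by linarith only [hVv', hδ]) hs0.le
  have hnw : ‖s • w‖ ≤ s * Vmax := by
    rw [norm_smul, Real.norm_eq_abs, abs_of_pos hs0]
    exact mul_le_mul_of_nonneg_left (by linarith only [hVw', hδ]) hs0.le
  have hn0 : ‖(0 : EuclideanSpace ℝ (Fin 4))‖ ≤ s * Vmax := by rw [norm_zero]; positivity
  have h2α : 2 * a β ≤ δ * s / 8 := by linarith only [hα16]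
  have hSf : (δ * s / 8 / (2 * a β)) ^ 4 ≤ ∑ x ∈ box 4 L, f (a β • siteToE x) :=
    pow_le_sum_box hf0 hα (fun z hz => hfone z hz) h2α (centre_cover hs0.le hn0 hδV hcov2)
  have hSg : (δ * s / 8 / (2 * a β)) ^ 4 ≤ ∑ y ∈ box 4 L, g (a β • siteToE y) :=
    pow_le_sum_box hg0 hα (fun z hz => hgone z hz) h2α (centre_cover hs0.le hnv hδV hcov2)
  have hSh : (δ * s / 8 / (2 * a β)) ^ 4 ≤ ∑ z ∈ box 4 L, h (a β • siteToE z) :=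
    pow_le_sum_box hh0 hα (fun z hz => hhone z hz) h2α (centre_cover hs0.le hnw hδV hcov2)
  -- summation: `σ Q3 ≥ ε`
  have hsum := mul_sum_mul_sum_mul_sum_le (B := box 4 L) (κ := c₃ * M₃ / (2 * s ^ 8) * a β ^ 12)
    (f := fun x => f (a β • siteToE x)) (g := fun y => g (a β • siteToE y))
    (h := fun z => h (a β • siteToE z)) (C := fun x y z => σ * torusK3 G r β L x y z)
    (fun x => hf0 _) (fun y => hg0 _) (fun z => hh0 _) key
  have hσQ : σ * Q3 G r β L (a β) f g h =
      ∑ x ∈ box 4 L, ∑ y ∈ box 4 L, ∑ z ∈ box 4 L,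
        f (a β • siteToE x) * g (a β • siteToE y) * h (a β • siteToE z) *
          (σ * torusK3 G r β L x y z) := by
    unfold Q3
    rw [Finset.mul_sum]
    refine Finset.sum_congr rfl fun x _ => ?_
    rw [Finset.mul_sum]
    refine Finset.sum_congr rfl fun y _ => ?_
    rw [Finset.mul_sum]
    refine Finset.sum_congr rfl fun z _ => ?_
    ring
  have hσabs : σ * Q3 G r β L (a β) f g h ≤ |Q3 G r β L (a β) f g h| := by
    rcases hσ with rfl | rfl
    · rw [one_mul]; exact le_abs_self _
    · rw [neg_one_mul]; exact neg_le_abs _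
  refine le_trans ?_ hσabs
  rw [hσQ]
  refine le_trans ?_ hsum
  have hα0 : a β ≠ 0 := hα.ne'
  have hpos : (0 : ℝ) ≤ (δ * s / 8 / (2 * a β)) ^ 4 := by positivity
  calc c₃ * M₃ / (2 * s ^ 8) * (δ * s / 16) ^ 12
      = c₃ * M₃ / (2 * s ^ 8) * a β ^ 12 *
          ((δ * s / 8 / (2 * a β)) ^ 4 * (δ * s / 8 / (2 * a β)) ^ 4 * (δ * s / 8 / (2 * a β)) ^ 4) := by
        field_simp; ring
    _ ≤ _ := mul_le_mul_of_nonneg_left (mul_le_mul (mul_le_mul hSf hSg hpos (hpos.trans hSf)) hSh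
        hpos (mul_nonneg (hpos.trans hSf) (hpos.trans hSg))) (by positivity)

end ThreePoint

end Summit.QuantumFields.YangMills.Cruxes.OSLegsFromFemtoAndGap.DlrCollarTransfer.StubLower

end
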